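import Summits.Ventures.PercRepro.GenQFrameDiag
import Summits.Ventures.PercRepro.GenQLevelThree

/-!
# PercRepro — C-025 at `(q + 2, q)` for every `q`: the residues start at level `4`, and the first open row
`(7, 5)` is ONE per-flat statement (night-4, gen 0)

Only rank-`q` FLATS enter the transfer, so the residue of record can be stated on flats
(`PerFlatResidueBelowFlat q`: the balance on the family `𝔉` at the types `t ≤ q − 1`, on the rank-`q` flats of
simple matroids).  With level `3` closed (`perFlatBelowFlat_three`, Theorem O's `(β)`):

* `rls_succ_succ_of_flats`: the core of the `(q + 2, q)` row from the balances of the types `t ≤ q − 1` on the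
  rank-`q` flats of THIS matroid (the local form of `rls_succ_succ_of_perFlatBelow`);
* **`rls_five_three_b`**: the `(5, 3)` row on every finite matroid, re-derived from the general machinery
  (`rls_diag 2` over Theorem N + the level-`3` balances);
* **`rls_succ_succ_all_flat`**: for every `q ≥ 3`, `RLS M (q + 2) q` on every finite matroid from
  `PerFlatResidueBelowFlat q′` for `4 ≤ q′ ≤ q`;
* `residueBelowFlat_four_of_typeThree`: level `4` is `TypeThreeSmall ∧ TwentyOnePrime` (with `SixFourT1`);
* **`rls_seven_five_of_residue`**: the FIRST OPEN ROW `(7, 5)` on every finite matroid from `TwentyOnePrime`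
  (riding) and the single statement `PerFlatResidueBelowFlat 5`.
-/

open scoped Matroid

namespace PercRepro.GenQ

open Finset ThmH PerFlat ThmN SixFour

/-! ## The core from the flats of one matroid -/

/-- **The core of the `(q + 2, q)` row from the balances on the rank-`q` flats of `M`** at the types `t ≤ q − 1`
(the local form of `rls_succ_succ_of_perFlatBelow`). -/
theorem rls_succ_succ_of_flats {α : Type} [DecidableEq α] (q : ℕ) (hq : 1 ≤ q) (M : Matroid α) [M.Finite]
    (hge : ((q + 2 : ℕ) : ℕ∞) ≤ M.eRank) (hcol : M.eRank = ((q + 2 : ℕ) : ℕ∞) → ∀ e, ¬ M.IsColoop e)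
    (hbelow : ∀ G ∈ flatsQ M q, ∀ t, t + 1 ≤ q → 0 ≤ Jq M G q t) : RLS M (q + 2) q := by
  unfold RLS
  rw [phiK_succ_succ]
  apply PerFlat.c025_of_perFlat_normalized M (q + 2) q (by positivity) (fHardQ M q)
    (fun P S => fHardQ_nonneg q P S)
  intro G hG
  have htq := typeOfQ_le_q hG hge
  by_cases htop : typeOfQ M q G = q
  · obtain ⟨h2, hR⟩ := eRk_sdiff_eq_two_of_typeOfQ_eq hq hG hge htop
    have h3 := three_le_card_sdiff_of_top (hcol hR) hR hG h2
    exact perFlat_of_Jq_nonneg' hG (t' := q - 1) (by omega) (by omega) (hbelow G hG (q - 1) (by omega))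
  · exact perFlat_of_Jq_nonneg' hG le_rfl (sub_typeOfQ_le_card q G) (hbelow G hG _ (by omega))

/-- **The per-flat residue at `(q + 2, q)` on flats**: the balance at the types `t ≤ q − 1` on the rank-`q` flats
of simple matroids that lie in the family `𝔉`. -/
def PerFlatResidueBelowFlat (q : ℕ) : Prop :=
  ∀ {β : Type} [DecidableEq β] (M : Matroid β) [M.Finite] (G : Finset β), Simple M → G ∈ flatsQ M q →
    TwoHyp M G q → ∀ t, t + 1 ≤ q → 0 ≤ Jq M G q t

/-- The core of the `(q + 2, q)` row from the flats-only residue (the dichotomy covers the flats off `𝔉`). -/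
theorem rls_succ_succ_of_residueBelowFlat {α : Type} [DecidableEq α] (q : ℕ) (hq : 1 ≤ q)
    (hres : PerFlatResidueBelowFlat q) (M : Matroid α) [M.Finite] (hs : Simple M)
    (hge : ((q + 2 : ℕ) : ℕ∞) ≤ M.eRank) (hcol : M.eRank = ((q + 2 : ℕ) : ℕ∞) → ∀ e, ¬ M.IsColoop e) :
    RLS M (q + 2) q := by
  apply rls_succ_succ_of_flats q hq M hge hcol
  intro G hG t ht
  have hGg : G ⊆ gr M := (mem_flatsQ.1 hG).1
  have hr : M.eRk (G : Set α) = (q : ℕ∞) := (mem_flatsQ.1 hG).2.2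
  by_cases hF : TwoHyp M G q
  · exact hres M G hs hG hF t ht
  · exact Jq_nonneg_of_not_twoHyp hGg hr hF (by omega)

/-! ## `(5, 3)` re-derived, and the rows from level `4` on -/

/-- **The `(5, 3)` row on every finite matroid, re-derived**: `rls_diag 2` over Theorem N at `(4, 2)` with the
level-`3` core from `perFlatBelowFlat_three` (Theorem O's `(β)` + the small cases). -/
theorem rls_five_three_b {α : Type} [DecidableEq α] (M : Matroid α) [M.Finite] : RLS M 5 3 := by
  have h := rls_diag (α := α) 2 (fun M _ => c025_two_all M 4 le_rfl) (fun M _ hs hR hcol =>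
    rls_succ_succ_of_flats 3 (by norm_num) M (by rw [hR]) (fun _ => hcol)
      (fun G hG t ht => perFlatBelowFlat_three hs hG t ht)) M
  exact h

/-- **The `(q + 2, q)` row on every finite matroid for every `q ≥ 3` from the flats-only residues of the levels
`4 … q`** (induction on `q` from `(5, 3)`; the step is `rls_diag` with `rls_succ_succ_of_residueBelowFlat`). -/
theorem rls_succ_succ_all_flat {α : Type} [DecidableEq α] (q : ℕ) (hq : 3 ≤ q)
    (hres : ∀ q', 4 ≤ q' → q' ≤ q → PerFlatResidueBelowFlat q') :
    ∀ (M : Matroid α) [M.Finite], RLS M (q + 2) q := by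
  induction q, hq using Nat.le_induction with
  | base => exact fun M _ => rls_five_three_b M
  | succ k hk ih =>
    have hprev : ∀ (M : Matroid α) [M.Finite], RLS M (k + 2) k :=
      ih (fun q' h4 hq' => hres q' h4 (by omega))
    have hres' : PerFlatResidueBelowFlat (k + 1) := hres (k + 1) (by omega) le_rfl
    intro M _
    exact rls_diag k hprev (fun M _ hs hR hcol =>
      rls_succ_succ_of_residueBelowFlat (k + 1) (by omega) hres' M hs (by rw [hR]) (fun _ => hcol)) M

/-- **Level `4` is `TypeThreeSmall ∧ TwentyOnePrime`** (with the landed `t ≤ 2` of `SixFourT1`). -/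
theorem residueBelowFlat_four_of_typeThree (h3s : TypeThreeSmall) (h3b : TwentyOnePrime) :
    PerFlatResidueBelowFlat 4 := by
  intro β _ M _ G hs hG _ t ht
  have hGg : G ⊆ gr M := (mem_flatsQ.1 hG).1
  have hr : M.eRk (G : Set β) = ((4 : ℕ) : ℕ∞) := (mem_flatsQ.1 hG).2.2
  have hr' : M.eRk (G : Set β) = 4 := by rw [hr]; rfl
  rw [Jq_four]
  rcases (show t = 0 ∨ t = 1 ∨ t = 2 ∨ t = 3 by omega) with rfl | rfl | rfl | rfl
  · exact J_zero_nonneg hs hGg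
  · exact J_one_nonneg hs hGg hr'
  · exact J_two_nonneg hs hGg hr'
  · by_cases hg : 10 ≤ G.card
    · exact h3b M G hs hGg hr' hg
    · exact h3s M G hs hGg hr' (by omega)

/-- **The first open row `(7, 5)` on every finite matroid from `TwentyOnePrime` and ONE per-flat statement**:
`PerFlatResidueBelowFlat 5` — the balances `0 ≤ Jq M G 5 t`, `t ≤ 4`, on the rank-`5` flats of simple matroids
that are covered by two hyperplane traces and two points. -/
theorem rls_seven_five_of_residue {α : Type} [DecidableEq α] (h3s : TypeThreeSmall) (h3b : TwentyOnePrime)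
    (hres : PerFlatResidueBelowFlat 5) (M : Matroid α) [M.Finite] : RLS M 7 5 := by
  have h := rls_succ_succ_all_flat (α := α) 5 (by norm_num) (fun q' h4 hq' => by
    rcases (show q' = 4 ∨ q' = 5 by omega) with rfl | rfl
    · exact residueBelowFlat_four_of_typeThree h3s h3b
    · exact hres) M
  exact h

end PercRepro.GenQ
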